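import Mathlib
import Summits.Ventures.PercRepro2.LocRows
import Summits.Ventures.PercRepro2.SwRow
import Summits.Ventures.PercRepro2.SwOut
import Summits.Ventures.PercRepro2.SwAllRow
import Summits.Ventures.PercRepro2.SwOutAll
import Summits.Ventures.PercRepro2.SwOutJunctionH1Defs
import Summits.Ventures.PercRepro2.SwOutJunctionH1BundleDefs
import Summits.Ventures.PercRepro2.SwOutJunctionH1BundleLift
import Summits.Ventures.PercRepro2.SwOutJunctionH1BundleUniform

/-!
# The bundle `h–u` by subdivision: `G⁺` satisfies the hypotheses of Theorem A (blind cell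
PercRepro2, night-4 g29, 2026-08-28; proofs/NIGHT4-G29.md §9)

The bundle version of `SwOutJunctionH1EdgeHyp`: with every edge `h–u` subdivided, `u` is not
adjacent to `h` in `G⁺` WITHOUT any uniqueness hypothesis (`bund_nadj`), every `w_b` carries the
outside edge `w_b–l` (`bund_hout`), loops stay away from `h` and `u` (`bund_loop_h`, `bund_loop_u`),
and the simple-arm hypothesis transfers (`bund_H1`, `compU_bund_subset`).  A uniform point of a class
of `G⁺` is the uniform lift of its restriction to `G` (`eq_blift_of_buniform`).
-/

namespace Summit.Ventures.PercRepro2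

namespace LocRows

open Hull

variable {V : Type*} {E : Type*}

open scoped Classical

section Hyp

variable {ends : E → Sym2 V} {h u l o : V} {U : Set V}

/-- `l` is outside `U⁺`. -/
lemma bund_hl (hl : l ∉ U) : (Sum.inl l : V ⊕ Bundle ends h u) ∉ bundRegion U := by simpa using hl

/-- `h ≠ u` in `G⁺`. -/
lemma bund_hhu (hhu : h ≠ u) : (Sum.inl h : V ⊕ Bundle ends h u) ≠ Sum.inl u :=
  fun h' => hhu (Sum.inl_injective h')

/-- No loop at `h` in `G⁺`. -/
lemma bund_loop_h (hloop_h : ∀ e, ends e ≠ s(h, h)) (e : E ⊕ (Bundle ends h u × Bool)) :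
    bundEnds ends h u l e ≠ s(Sum.inl h, Sum.inl h) := by
  rcases e with e | ⟨b, c⟩
  · by_cases hb : ends e = s(h, u)
    · rw [bundEnds_inl_of_hu hb, Ne, Sym2.eq_iff]
      simp
    · exact bundEnds_inl_ne_of_ne hb (hloop_h e)
  · cases c
    · rw [bundEnds_inr_false, Ne, Sym2.eq_iff]
      simp
    · rw [bundEnds_inr_true, Ne, Sym2.eq_iff]
      simp

/-- No loop at `u` in `G⁺`. -/
lemma bund_loop_u (hloop_u : ∀ e, ends e ≠ s(u, u)) (e : E ⊕ (Bundle ends h u × Bool)) :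
    bundEnds ends h u l e ≠ s(Sum.inl u, Sum.inl u) := by
  rcases e with e | ⟨b, c⟩
  · by_cases hb : ends e = s(h, u)
    · rw [bundEnds_inl_of_hu hb, Ne, Sym2.eq_iff]
      simp
    · exact bundEnds_inl_ne_of_ne hb (hloop_u e)
  · cases c
    · rw [bundEnds_inr_false, Ne, Sym2.eq_iff]
      simp
    · rw [bundEnds_inr_true, Ne, Sym2.eq_iff]
      simp

/-- **`u` is not adjacent to `h` in `G⁺`**: every edge `h–u` of `G` has been subdivided. -/
lemma bund_nadj (e : E ⊕ (Bundle ends h u × Bool)) :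
    bundEnds ends h u l e ≠ s(Sum.inl h, Sum.inl u) := by
  rcases e with e | ⟨b, c⟩
  · by_cases hb : ends e = s(h, u)
    · rw [bundEnds_inl_of_hu hb, Ne, Sym2.eq_iff]
      simp
    · exact bundEnds_inl_ne_of_ne hb hb
  · cases c
    · rw [bundEnds_inr_false, Ne, Sym2.eq_iff]
      simp
    · rw [bundEnds_inr_true, Ne, Sym2.eq_iff]
      simp

/-- A vertex `v` of `G` with no edge has no edge in `G⁺` (when `v ∉ {h, u, l}`). -/
lemma bund_notMem_of_notMem {v : V} (hiso : ∀ e, v ∉ ends e) (hvh : v ≠ h) (hvu : v ≠ u)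
    (hvl : v ≠ l) (e : E ⊕ (Bundle ends h u × Bool)) : Sum.inl v ∉ bundEnds ends h u l e := by
  rcases e with e | ⟨b, c⟩
  · by_cases hb : ends e = s(h, u)
    · rw [bundEnds_inl_of_hu hb, Sym2.mem_iff]
      simp [hvh]
    · rw [bundEnds_inl_of_ne hb, Sym2.mem_map]
      rintro ⟨a, ha, hav⟩
      exact hiso e ((Sum.inl_injective hav) ▸ ha)
  · cases c
    · rw [bundEnds_inr_false, Sym2.mem_iff]
      simp [hvu]
    · rw [bundEnds_inr_true, Sym2.mem_iff]
      simp [hvl]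

/-- **Every non-mark vertex of `U⁺` other than `u` carries an outside edge or no edge**: each `w_b`
has the edge `w_b–l`, the vertices of `G` what they had. -/
lemma bund_hout (hl : l ∉ U)
    (hout : ∀ x ∈ U, x ≠ h → x ≠ o → x ≠ u →
      (∃ e y, ends e = s(x, y) ∧ y ∉ U) ∨ (∀ e, x ∉ ends e)) :
    ∀ x ∈ bundRegion U, x ≠ Sum.inl h → x ≠ Sum.inl o → x ≠ Sum.inl u →
      (∃ e y, bundEnds ends h u l e = s(x, y) ∧ y ∉ bundRegion U) ∨
        (∀ e, x ∉ bundEnds ends h u l e) := by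
  rintro (v | b) hx hxh hxo hxu
  · rw [inl_mem_bundRegion_iff] at hx
    have hvh : v ≠ h := fun h' => hxh (by rw [h'])
    have hvo : v ≠ o := fun h' => hxo (by rw [h'])
    have hvu : v ≠ u := fun h' => hxu (by rw [h'])
    have hvl : v ≠ l := fun h' => hl (h' ▸ hx)
    rcases hout v hx hvh hvo hvu with ⟨e, y, hey, hyU⟩ | hiso
    · have hb : ends e ≠ s(h, u) := by
        intro hb
        rw [hb, Sym2.eq_iff] at hey
        rcases hey with ⟨h1, _⟩ | ⟨_, h2⟩
        · exact hvh h1.symm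
        · exact hvu h2.symm
      exact Or.inl ⟨Sum.inl e, Sum.inl y, by rw [bundEnds_inl_of_ne hb, hey, Sym2.map_mk],
        by simpa using hyU⟩
    · exact Or.inr (bund_notMem_of_notMem hiso hvh hvu hvl)
  · exact Or.inl ⟨Sum.inr (b, true), Sum.inl l, bundEnds_inr_true b, by simpa using hl⟩

/-- Every `w_b` is isolated in `G⁺[U⁺ ∖ {h, u}]`: the component of a vertex of `G` there lies in the
image of its component in `G[U ∖ {h, u}]`. -/
lemma compU_bund_subset (hl : l ∉ U) (q : V) :
    compU (bundEnds ends h u l) (bundRegion U) (Sum.inl h) (Sum.inl u) (Sum.inl q) ⊆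
      {y | ∃ v ∈ compU ends U h u q, y = Sum.inl v} := by
  intro y hy
  refine mem_of_conn_of_closed (ends := bundEnds ends h u l)
    (ω := fun e => decide (e ∈ within (bundEnds ends h u l)
      (bundRegion U \ {Sum.inl h, Sum.inl u})))
    ?_ ⟨q, mem_cluster_self _ _ _, rfl⟩ hy
  rintro a ⟨v, hv, rfl⟩ b hab
  obtain ⟨_, e, he, hends⟩ := openGraph_adj.1 hab
  simp only [decide_eq_true_eq] at he
  obtain ⟨x, hx, y', hy', hxy⟩ := he
  rcases e with e | ⟨b', c⟩
  · by_cases hb : ends e = s(h, u)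
    · exfalso
      rw [bundEnds_inl_of_hu hb, Sym2.eq_iff] at hxy
      rcases hxy with ⟨h1, _⟩ | ⟨h1, _⟩
      · exact hx.2 (by rw [← h1]; simp)
      · exact hy'.2 (by rw [← h1]; simp)
    · obtain ⟨p', q', hpq⟩ := exists_pair_eq' (ends e)
      have hsub : bundEnds ends h u l (Sum.inl e) = s(Sum.inl p', Sum.inl q') := by
        rw [bundEnds_inl_of_ne hb, hpq, Sym2.map_mk]
      have hmem : ∀ z : V ⊕ Bundle ends h u, z ∈ bundRegion U \ {Sum.inl h, Sum.inl u} →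
          ∀ z', z = Sum.inl z' → z' ∈ U \ {h, u} := by
        rintro z ⟨hzU, hz⟩ z' rfl
        refine ⟨by simpa using hzU, ?_⟩
        simp only [Set.mem_insert_iff, Set.mem_singleton_iff, Sum.inl.injEq] at hz ⊢
        exact hz
      have hopen : (fun e => decide (e ∈ within ends (U \ {h, u}))) e = true := by
        simp only [decide_eq_true_eq]
        rw [hsub, Sym2.eq_iff] at hxy
        rcases hxy with ⟨rfl, rfl⟩ | ⟨rfl, rfl⟩
        · exact ⟨p', hmem _ hx p' rfl, q', hmem _ hy' q' rfl, hpq⟩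
        · exact ⟨q', hmem _ hx q' rfl, p', hmem _ hy' p' rfl, ends_swap hpq⟩
      rw [hsub, Sym2.eq_iff] at hends
      rcases hends with ⟨h1, h2⟩ | ⟨h1, h2⟩
      · have hvp : v = p' := (Sum.inl_injective h1).symm
        subst hvp
        exact ⟨q', mem_cluster_of_edge hv hopen hpq, h2.symm⟩
      · have hvq : v = q' := (Sum.inl_injective h2).symm
        subst hvq
        exact ⟨p', mem_cluster_of_edge hv hopen (ends_swap hpq), h1.symm⟩
  · exfalso
    cases c
    · rw [bundEnds_inr_false, Sym2.eq_iff] at hxy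
      rcases hxy with ⟨_, h2⟩ | ⟨_, h2⟩
      · exact hy'.2 (by rw [← h2]; simp)
      · exact hx.2 (by rw [← h2]; simp)
    · rw [bundEnds_inr_true, Sym2.eq_iff] at hxy
      rcases hxy with ⟨_, h2⟩ | ⟨_, h2⟩
      · exact hl (by have := hy'.1; rw [← h2] at this; simpa using this)
      · exact hl (by have := hx.1; rw [← h2] at this; simpa using this)

/-- No edge of `G⁺` joins `h` to a vertex `q` of `G` that `h` is not adjacent to in `G`. -/
lemma bund_no_h_edge {q : V} (hq : ∀ e', ends e' ≠ s(h, q)) (e : E ⊕ (Bundle ends h u × Bool)) :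
    bundEnds ends h u l e ≠ s(Sum.inl h, Sum.inl q) := by
  rcases e with e | ⟨b, c⟩
  · by_cases hb : ends e = s(h, u)
    · rw [bundEnds_inl_of_hu hb, Ne, Sym2.eq_iff]
      simp
    · exact bundEnds_inl_ne_of_ne hb (hq e)
  · cases c
    · rw [bundEnds_inr_false, Ne, Sym2.eq_iff]
      simp
    · rw [bundEnds_inr_true, Ne, Sym2.eq_iff]
      simp

/-- **The simple-arm hypothesis transfers to `G⁺`**: the neighbours `w_b` of `u` are adjacent to `h`;
a neighbour `q` of `u` in `G` is adjacent to `h` or in an `h`-free component, and the components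
of `G⁺[U⁺ ∖ {h, u}]` are those of `G[U ∖ {h, u}]`. -/
lemma bund_H1 (hl : l ∉ U) (hhu : h ≠ u) (hloop_u : ∀ e, ends e ≠ s(u, u)) (hH1 : H1 ends U h u) :
    H1 (bundEnds ends h u l) (bundRegion U) (Sum.inl h) (Sum.inl u) := by
  intro e p hep
  rcases e with e | ⟨b, c⟩
  · by_cases hb : ends e = s(h, u)
    · exfalso
      rw [bundEnds_inl_of_hu hb, Sym2.eq_iff] at hep
      rcases hep with ⟨h1, _⟩ | ⟨_, h2⟩
      · exact hhu (Sum.inl_injective h1)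
      · exact absurd h2 (by simp)
    · obtain ⟨p', q', hpq⟩ := exists_pair_eq' (ends e)
      rw [bundEnds_inl_of_ne hb, hpq, Sym2.map_mk, Sym2.eq_iff] at hep
      obtain ⟨q, hq, rfl⟩ : ∃ q, ends e = s(u, q) ∧ p = Sum.inl q := by
        rcases hep with ⟨h1, h2⟩ | ⟨h1, h2⟩
        · exact ⟨q', by rw [hpq, Sum.inl_injective h1], h2.symm⟩
        · exact ⟨p', by rw [hpq, Sum.inl_injective h2, Sym2.eq_swap], h1.symm⟩
      rcases hH1 e q hq with ⟨e', he'⟩ | hfree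
      · left
        have he'b : ends e' ≠ s(h, u) := by
          intro hb'
          rw [hb', Sym2.eq_iff] at he'
          rcases he' with ⟨_, h2⟩ | ⟨_, h2⟩
          · exact hhu h2.symm
          · exact hloop_u e (by rw [hq, ← h2])
        exact ⟨Sum.inl e', by rw [bundEnds_inl_of_ne he'b, he', Sym2.map_mk]⟩
      · right
        intro qq hqq e'
        obtain ⟨v, hv, rfl⟩ := compU_bund_subset hl q hqq
        exact bund_no_h_edge (hfree v hv) e'
  · left
    cases c
    · rw [bundEnds_inr_false, Sym2.eq_iff] at hep
      rcases hep with ⟨h1, _⟩ | ⟨h1, _⟩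
      · exact absurd h1 (by simp)
      · exact ⟨Sum.inl b.1, by rw [bundEnds_inl_bundle, ← h1, Sym2.eq_swap]⟩
    · rw [bundEnds_inr_true, Sym2.eq_iff] at hep
      rcases hep with ⟨h1, _⟩ | ⟨h1, _⟩
      · exact absurd h1 (by simp)
      · exact ⟨Sum.inl b.1, by rw [bundEnds_inl_bundle, ← h1, Sym2.eq_swap]⟩

end Hyp

/-! ## Uniform class points are uniform lifts -/

section Lifts

variable [Fintype E] [DecidableEq E] {ends : E → Sym2 V} {h u l : V} {U : Set V}

/-- **A uniform point of a class of `G⁺` is the uniform lift of its restriction to `G`**: the class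
keeps `l` out of the hull of `h`, which forces each `w_b–l` to take the colour opposite to `h–w_b`. -/
theorem eq_blift_of_buniform (hl : l ∉ U) {ξ' ζ' : Config (E ⊕ (Bundle ends h u × Bool))}
    (hζ' : ζ' ∈ outClass (bundEnds ends h u l) (bundRegion U) (Sum.inl h) ξ')
    (hun : BUniform ζ') : ζ' = blift (ζ' ∘ Sum.inl) := by
  have hsub := (mem_outClass.1 hζ').2
  have hlU : (Sum.inl l : V ⊕ Bundle ends h u) ∉ bundRegion U := by simpa using hl
  funext e
  rcases e with e | ⟨b, c⟩
  · rfl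
  · cases c
    · exact (hun b).symm
    · simp only [blift_inr_true, Function.comp_apply]
      cases hc : ζ' (Sum.inl b.1)
      · by_contra hne
        simp only [Bool.not_false, Bool.not_eq_true] at hne
        apply hlU
        apply hsub
        right
        have hw : Sum.inr b ∈ cluster (bundEnds ends h u l) (blue ζ') (Sum.inl h) :=
          mem_cluster_of_edge (e := Sum.inl b.1) (mem_cluster_self _ _ _)
            (by rw [blue_eq_true_iff]; exact hc) (bundEnds_inl_bundle b)
        exact mem_cluster_of_edge (e := Sum.inr (b, true)) hw
          (by rw [blue_eq_true_iff]; exact hne) (bundEnds_inr_true b)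
      · by_contra hne
        simp only [Bool.not_true, Bool.not_eq_false] at hne
        apply hlU
        apply hsub
        left
        have hw : Sum.inr b ∈ cluster (bundEnds ends h u l) ζ' (Sum.inl h) :=
          mem_cluster_of_edge (e := Sum.inl b.1) (mem_cluster_self _ _ _) hc (bundEnds_inl_bundle b)
        exact mem_cluster_of_edge (e := Sum.inr (b, true)) hw hne (bundEnds_inr_true b)

end Lifts

end LocRows

end Summit.Ventures.PercRepro2
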